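import Literature.AlgebraicGeometry.Motives.HodgeThetaSubalgebraUnitaryFourCoprimeCore
import HarnessLib

/-!
# The unitary `Θ`-subalgebra theorem: the generic inductive step and the cores `(4, 5)`, `(5, 7)`, `(6, 7)`
# (Ribet 1983, Thm. 3 at `(n′, n″) = (4,5), (5,7), (6,7)` — abelian 9-, 12-, 13-folds — classification-free)

Family `hodge`, layer `Literature/AlgebraicGeometry/Motives` (pure linear algebra over `ℂ`; no geometry). Research
context: cell `pub-hodge-ring2` (HONEST FRAMING: research route conditional on HC_CM; not a corollary; Q11.4-sentence-2
already refuted in dim ≥ 3), Literature lane gen 83, programme R64. UNCONDITIONAL; theorems only, no definition, no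
named fact (D-0026), no `sorry`. Sequel of `HodgeThetaSubalgebraUnitaryRaisingRank` §3 (the sharp raising-rank lemma
`exists_raise_rank_gt_of_two_le`) and of `HodgeThetaSubalgebraUnitaryFourCoprimeCore` (whose step lemma it generalises
to any `dim P = a`).

THE PRINTED THEOREM. Ribet, Amer. J. Math. 105 (1983), Thm. 3 = Gordon's survey Thm. 6.3 (3) [held
`paper:arxiv-alg-geom_9709030` p. 18]: `End⁰ = k` imaginary quadratic with coprime multiplicities `(n′, n″)` ⟹
`Hg = U(V, φ)`, `B•(Xⁿ) = D•(Xⁿ)`. Lie step, classification-free, as an INDUCTION ON CORES: a core of type `(a | b)` follows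
from (i) cores of types `(r | b − r)` for `2 ≤ r < a` (they raise the rank of a raising operator from `2` to `a`, one step
at a time, by the sharp raising-rank lemma — needs `b ≥ a + 1`) and (ii) the core of type `(a | b − a)` (Levi algebra of `Q`
after a full-rank raising operator). With the tree's cores `(m|1)`, `(2|odd)`, `(odd|2)`, `(3|3∤·)`, `(3∤·|3)` this gives
here `(4|5)` [(2|3), (3|2); (4|1)], `(5|7)` [(2|5), (3|4), (4|3); (5|2)], `(6|7)` [(2|5), (3|4), (4|3), (5|2); (6|1)].

* §1 **`UnitaryCoprimeStep.exists_raise_onto_of_cores`** — `dim P = a ≥ 2`, `dim Q ≥ a + 1`, cores `(r | dim Q − r)` for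
  `2 ≤ r < a` ⟹ a raising operator onto `P`.
* §2 **`UnitaryCoprimeStep.eq_top_of_onto_of_core`** — a raising operator onto `P` and the `(a | b − a)` core ⟹ `𝔊 = End(W)`.
* §3 **`eq_top_four_five`, `eq_top_five_four`, `eq_top_five_seven`, `eq_top_seven_five`, `eq_top_six_seven`,
  `eq_top_seven_six`** — the cores.

## References
* [Ribet1983] K. A. Ribet, Amer. J. Math. 105 (1983), Thm. 3.
* [Gordon1997] B. B. Gordon, *A survey of the Hodge conjecture for abelian varieties*, Thm. 6.3 (3), pp. 18–19.
* [Deligne1982HodgeCycles] P. Deligne, LNM 900 (1982), I §3 Prop. 3.4, 3.6.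
* [HoffmanKunze1971LinearAlgebra] K. Hoffman, R. Kunze, *Linear Algebra* (1971), §6.8 Thm. 12 (projections from polynomials).
* [GoodmanWallachGTM255] R. Goodman, N. R. Wallach, GTM 255 (2009), §4.1.1.
-/

noncomputable section

namespace Literature.AlgebraicGeometry.Motives

namespace HodgeStructure

universe u

variable {W : Type u} [AddCommGroup W] [Module ℂ W]

section Main

/-! ### §1 Raising the rank up to `dim P` -/

/-- **A raising operator onto `P` from the lower cores.** `dim P = a ≥ 2`, `dim Q ≥ a + 1`, and for every `2 ≤ r < a` the
abstract core of type `(r | dim Q − r)` (hypothesis-schema `hcores`) ⟹ some raising `B ∈ 𝔊` maps onto `P`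
(`UnitaryThreeCoprime.exists_raise_rank_ge_two`, then `UnitaryRaisingRank.exists_raise_rank_gt_of_two_le` repeatedly).
[cite: Ribet1983, Thm. 3] [cite: Deligne1982HodgeCycles, I §3 Prop. 3.6] -/
theorem UnitaryCoprimeStep.exists_raise_onto_of_cores [FiniteDimensional ℂ W] {𝔊 : Submodule ℂ (Module.End ℂ W)}
    (hbr : ∀ Y ∈ 𝔊, ∀ Z ∈ 𝔊, Y * Z - Z * Y ∈ 𝔊)
    (hirr : ∀ U : Submodule ℂ W, (∀ A ∈ 𝔊, ∀ u ∈ U, A u ∈ U) → U = ⊥ ∨ U = ⊤)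
    {Θ : Module.End ℂ W} (hΘ : Θ ∈ 𝔊) (hΘΘ : Θ * Θ = 1)
    {P Q : Submodule ℂ W} (hP : ∀ x, x ∈ P ↔ Θ x = x) (hQ : ∀ x, x ∈ Q ↔ Θ x = -x)
    {a : ℕ} (hPa : Module.finrank ℂ P = a) (ha : 2 ≤ a) (hQa : a + 1 ≤ Module.finrank ℂ Q)
    {s : W → W → ℂ} (hadd : ∀ x y z, s (x + y) z = s x z + s y z) (hsymm : ∀ x y, s y x = starRingEnd ℂ (s x y))
    (hPQ : ∀ p ∈ P, ∀ q ∈ Q, s p q = 0) (hdefP : ∀ p ∈ P, s p p = 0 → p = 0) (hdefQ : ∀ q ∈ Q, s q q = 0 → q = 0)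
    (hadj : ∀ X ∈ 𝔊, ∃ Y ∈ 𝔊, ∀ x y, s (X x) y = s x (Y y))
    (hcores : ∀ r : ℕ, 2 ≤ r → r < a →
      ∀ (U : Submodule ℂ W) (𝔩 : Submodule ℂ (Module.End ℂ U)) (ι : Module.End ℂ U) (P' Q' : Submodule ℂ U),
      (∀ A ∈ 𝔩, ∀ A' ∈ 𝔩, A * A' - A' * A ∈ 𝔩) →
      (∀ V : Submodule ℂ U, (∀ A ∈ 𝔩, ∀ u ∈ V, A u ∈ V) → V = ⊥ ∨ V = ⊤) →
      ι ∈ 𝔩 → ι * ι = 1 → (∀ x, x ∈ P' ↔ ι x = x) → (∀ x, x ∈ Q' ↔ ι x = -x) →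
      Module.finrank ℂ P' = r → Module.finrank ℂ Q' + r = Module.finrank ℂ Q →
      (∀ p ∈ P', ∀ q ∈ Q', s (p : W) q = 0) → (∀ p ∈ P', s (p : W) p = 0 → p = 0) →
      (∀ q ∈ Q', s (q : W) q = 0 → q = 0) →
      (∀ A ∈ 𝔩, ∃ A' ∈ 𝔩, ∀ x y : U, s ((A x : U) : W) y = s x ((A' y : U) : W)) → 𝔩 = ⊤) :
    ∃ B ∈ 𝔊, Θ * B = B ∧ B * Θ = -B ∧ ∀ p ∈ P, ∃ w, B w = p := by
  classical
  have hraiseval : ∀ Z : Module.End ℂ W, Θ * Z = Z → ∀ w, Z w ∈ P := fun Z hΘZ w =>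
    (hP _).2 (by rw [← Module.End.mul_apply, hΘZ])
  have hlea : ∀ B' : Module.End ℂ W, Θ * B' = B' → Module.finrank ℂ (LinearMap.range B') ≤ a := fun B' h => by
    rw [← hPa]
    exact Submodule.finrank_mono (by rintro _ ⟨w, rfl⟩; exact hraiseval B' h w)
  have honto : ∀ B' : Module.End ℂ W, Θ * B' = B' → a ≤ Module.finrank ℂ (LinearMap.range B') →
      ∀ p ∈ P, ∃ w, B' w = p := by
    intro B' hΘB' h4 p hp
    have hle : LinearMap.range B' ≤ P := by rintro _ ⟨w, rfl⟩; exact hraiseval B' hΘB' w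
    have heq : LinearMap.range B' = P := Submodule.eq_of_le_of_finrank_le hle (by rw [hPa]; exact h4)
    have hp' : p ∈ LinearMap.range B' := heq ▸ hp
    exact hp'
  have key : ∀ k : ℕ, ∀ B' ∈ 𝔊, Θ * B' = B' → B' * Θ = -B' → a ≤ Module.finrank ℂ (LinearMap.range B') + k →
      2 ≤ Module.finrank ℂ (LinearMap.range B') → ∃ B ∈ 𝔊, Θ * B = B ∧ B * Θ = -B ∧ ∀ p ∈ P, ∃ w, B w = p := by
    intro k
    induction k with
    | zero =>
      intro B' hB' hΘB' hB'Θ hk _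
      exact ⟨B', hB', hΘB', hB'Θ, honto B' hΘB' (by omega)⟩
    | succ k ih =>
      intro B' hB' hΘB' hB'Θ hk h2
      by_cases hge : a ≤ Module.finrank ℂ (LinearMap.range B') + k
      · exact ih B' hB' hΘB' hB'Θ hge h2
      have hlt : Module.finrank ℂ (LinearMap.range B') < a := by omega
      obtain ⟨B'', hB'', hΘB'', hB''Θ, hrk⟩ := UnitaryRaisingRank.exists_raise_rank_gt_of_two_le hbr hirr hΘ hΘΘ hP hQ
        hadd hsymm hPQ hdefP hdefQ hadj hB' hΘB' hB'Θ (by omega) (by omega) (by omega)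
        fun U 𝔩 ι P' Q' h1 h2' h3 h4 h5 h6 hfinP' hfinQ' h7 h8 h9 h10 =>
          hcores (Module.finrank ℂ (LinearMap.range B')) h2 hlt U 𝔩 ι P' Q' h1 h2' h3 h4 h5 h6 hfinP' hfinQ' h7 h8 h9 h10
      exact ih B'' hB'' hΘB'' hB''Θ (by omega) (by omega)
  obtain ⟨B₂, hB₂, hΘB₂, hB₂Θ, hrk₂⟩ :=
    UnitaryThreeCoprime.exists_raise_rank_ge_two hbr hirr hΘ hΘΘ hP hQ (by omega) (by omega)
  exact key a B₂ hB₂ hΘB₂ hB₂Θ (by omega) hrk₂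

/-! ### §2 The inductive step `(a | b − a) ⟹ (a | b)` given a raising operator onto `P` -/

/-- **The `(a | b)` core from a raising operator onto `P` and the `(a | b − a)` core** (`2 ≤ a < b`): verbatim the
inductive step of `UnitaryThreeCoprime.eq_top` / `UnitaryFourCoprime.eq_top_of_core` for general `a` — adjoint `C`
(injective on `P`), Cayley–Hamilton idempotent `E ∈ 𝔊` onto `ker B|_Q` along `C(P)`, the Levi algebra `𝔩 ⊆ End(Q)` with
the involution `1 − 2E|_Q` of type `(a | b − a)` (irreducible, adjoint-closed) to which `hIH` applies, the `𝔑`-trick.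
[cite: Ribet1983, Thm. 3] [cite: HoffmanKunze1971LinearAlgebra, §6.8 Thm. 12] [cite: GoodmanWallachGTM255, §4.1.1] -/
theorem UnitaryCoprimeStep.eq_top_of_onto_of_core [FiniteDimensional ℂ W] {𝔊 : Submodule ℂ (Module.End ℂ W)}
    (hbr : ∀ Y ∈ 𝔊, ∀ Z ∈ 𝔊, Y * Z - Z * Y ∈ 𝔊)
    (hirr : ∀ U : Submodule ℂ W, (∀ A ∈ 𝔊, ∀ u ∈ U, A u ∈ U) → U = ⊥ ∨ U = ⊤)
    {Θ : Module.End ℂ W} (hΘ : Θ ∈ 𝔊) (hΘΘ : Θ * Θ = 1)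
    {P Q : Submodule ℂ W} (hP : ∀ x, x ∈ P ↔ Θ x = x) (hQ : ∀ x, x ∈ Q ↔ Θ x = -x)
    {a b : ℕ} (hPa : Module.finrank ℂ P = a) (hQb : Module.finrank ℂ Q = b) (ha : 2 ≤ a) (hab : a < b)
    {s : W → W → ℂ} (hadd : ∀ x y z, s (x + y) z = s x z + s y z) (hsymm : ∀ x y, s y x = starRingEnd ℂ (s x y))
    (hPQ : ∀ p ∈ P, ∀ q ∈ Q, s p q = 0) (hdefP : ∀ p ∈ P, s p p = 0 → p = 0) (hdefQ : ∀ q ∈ Q, s q q = 0 → q = 0)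
    (hadj : ∀ X ∈ 𝔊, ∃ Y ∈ 𝔊, ∀ x y, s (X x) y = s x (Y y))
    (honto : ∃ B ∈ 𝔊, Θ * B = B ∧ B * Θ = -B ∧ ∀ p ∈ P, ∃ w, B w = p)
    (hIH : ∀ (𝔩 : Submodule ℂ (Module.End ℂ Q)) (ι : Module.End ℂ Q) (P' Q' : Submodule ℂ Q),
      (∀ A ∈ 𝔩, ∀ A' ∈ 𝔩, A * A' - A' * A ∈ 𝔩) →
      (∀ V : Submodule ℂ Q, (∀ A ∈ 𝔩, ∀ u ∈ V, A u ∈ V) → V = ⊥ ∨ V = ⊤) →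
      ι ∈ 𝔩 → ι * ι = 1 → (∀ x, x ∈ P' ↔ ι x = x) → (∀ x, x ∈ Q' ↔ ι x = -x) →
      Module.finrank ℂ P' = a → Module.finrank ℂ Q' = b - a →
      (∀ p ∈ P', ∀ q ∈ Q', s (p : W) q = 0) → (∀ p ∈ P', s (p : W) p = 0 → p = 0) →
      (∀ q ∈ Q', s (q : W) q = 0 → q = 0) →
      (∀ A ∈ 𝔩, ∃ A' ∈ 𝔩, ∀ x y : Q, s ((A x : Q) : W) y = s x ((A' y : Q) : W)) → 𝔩 = ⊤) : 𝔊 = ⊤ := by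
  classical
  have hΘΘv : ∀ v, Θ (Θ v) = v := fun v => by rw [← Module.End.mul_apply, hΘΘ, Module.End.one_apply]
  have hPhat : ∀ w, (2 : ℂ)⁻¹ • (w + Θ w) ∈ P := fun w => (hP _).2 (by rw [map_smul, map_add, hΘΘv, add_comm])
  have hQhat : ∀ w, (2 : ℂ)⁻¹ • (w - Θ w) ∈ Q := fun w =>
    (hQ _).2 (by rw [map_smul, map_sub, hΘΘv, ← smul_neg, neg_sub])
  have hsplit : ∀ w, (2 : ℂ)⁻¹ • (w + Θ w) + (2 : ℂ)⁻¹ • (w - Θ w) = w := fun w => by module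
  obtain ⟨-, h0r, h0l, -, -, hsubr, -⟩ := UnitaryTwoOdd.herm_right hadd hsymm
  have hP0 : ∃ p : W, p ≠ 0 ∧ Θ p = p := by
    have hpos : 0 < Module.finrank ℂ P := by omega
    obtain ⟨⟨p, hp⟩, hp0⟩ := Module.finrank_pos_iff_exists_ne_zero.1 hpos
    exact ⟨p, fun h => hp0 (Subtype.ext h), (hP p).1 hp⟩
  have hraiseval : ∀ Z : Module.End ℂ W, Θ * Z = Z → ∀ w, Z w ∈ P := fun Z hΘZ w =>
    (hP _).2 (by rw [← Module.End.mul_apply, hΘZ])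
  -- STEP A: a rank-one idempotent in `𝔊`
  suffices hrank : ∃ (u : W) (φ : Module.Dual ℂ W), φ u = 1 ∧ φ.smulRight u ∈ 𝔊 by
    obtain ⟨u, φ, hφu, he⟩ := hrank
    exact UnitaryTwoOdd.eq_top_of_rankOne hbr hirr hφu he
  -- `dim Q ≥ 4`: the inductive case
  obtain ⟨B, hB, hΘB, hBΘ, honto⟩ := honto
  obtain ⟨C, hC, hBC⟩ := hadj B hB
  obtain ⟨hΘC, hCΘ⟩ := UnitaryTwoOdd.lower_of_adjoint hadd hsymm hΘΘ hP hQ hPQ hdefP hdefQ hΘB hBΘ hBC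
  have hinj := UnitaryTwoOdd.injOn_of_adjoint hadd hsymm hΘΘ hP hQ hPQ hdefP hdefQ hΘB hBΘ hBC honto
  obtain ⟨E, hE, hEP, hEW, hEK, hECP, hEker, hfinmap, hsup, hinf⟩ :=
    UnitaryTwoOdd.exists_idempotent_of_fullRank_pair hbr hΘ hΘΘ hP hQ hB hC hΘB hBΘ hΘC hCΘ hinj
  set K : Submodule ℂ W := Q ⊓ LinearMap.ker (C * B) with hKdef
  have hKQ : K ≤ Q := inf_le_left
  have hmapQ : P.map C ≤ Q := le_sup_right.trans hsup.le
  have hCmem : ∀ w, C w ∈ Q := fun w => (hQ _).2 (by rw [← Module.End.mul_apply, hΘC, LinearMap.neg_apply])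
  have hEQ : ∀ w, E w ∈ Q := fun w => hKQ (hEW w)
  have hEE : ∀ w, E (E w) = E w := fun w => hEK _ (hEW w)
  have hBK : ∀ k ∈ K, B k = 0 := fun k hk => by
    have hCBk : C (B k) = 0 := by
      have h := LinearMap.mem_ker.1 (Submodule.mem_inf.1 hk).2
      rwa [Module.End.mul_apply] at h
    exact hdefP _ (hraiseval B hΘB k) (by rw [hBC, hCBk, h0r])
  have hCinj : ∀ p ∈ P, C p = 0 → p = 0 := fun p hp h0 => hinj p hp (by rw [h0, map_zero])
  -- `E` commutes with `Θ`
  have hEΘ : E * Θ = Θ * E := by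
    refine LinearMap.ext fun w => ?_
    have hΘw : Θ w = (2 : ℂ)⁻¹ • (w + Θ w) - (2 : ℂ)⁻¹ • (w - Θ w) := by module
    rw [Module.End.mul_apply, Module.End.mul_apply, hΘw, map_sub, hEP _ (hPhat w), zero_sub,
      (hQ _).1 (hEQ w)]
    conv_rhs => rw [← hsplit w, map_add, hEP _ (hPhat w), zero_add]
  -- dimensions
  have hfinK : Module.finrank ℂ K = b - a := by
    have h := Submodule.finrank_sup_add_finrank_inf_eq K (P.map C)
    rw [hsup, hinf, finrank_bot, add_zero, hfinmap, hPa, hQb] at h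
    omega
  -- the Levi restriction algebra `𝔩 ⊆ End(Q)`
  set 𝔩 : Submodule ℂ (Module.End ℂ Q) :=
    { carrier := {A | ∃ Z ∈ 𝔊, Z * Θ = Θ * Z ∧ ∀ q : Q, ((A q : Q) : W) = Z q}
      zero_mem' := ⟨0, Submodule.zero_mem _, by rw [zero_mul, mul_zero], fun q => by simp⟩
      add_mem' := by
        rintro A A' ⟨Z, hZ, hZΘ, hAZ⟩ ⟨Z', hZ', hZ'Θ, hAZ'⟩
        exact ⟨Z + Z', Submodule.add_mem _ hZ hZ', by rw [add_mul, mul_add, hZΘ, hZ'Θ], fun q => by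
          rw [LinearMap.add_apply, Submodule.coe_add, hAZ, hAZ', LinearMap.add_apply]⟩
      smul_mem' := by
        rintro c A ⟨Z, hZ, hZΘ, hAZ⟩
        exact ⟨c • Z, Submodule.smul_mem _ c hZ, by rw [smul_mul_assoc, mul_smul_comm, hZΘ], fun q => by
          rw [LinearMap.smul_apply, Submodule.coe_smul, hAZ, LinearMap.smul_apply]⟩ } with h𝔩def
  have hmem𝔩 : ∀ A, A ∈ 𝔩 ↔ ∃ Z ∈ 𝔊, Z * Θ = Θ * Z ∧ ∀ q : Q, ((A q : Q) : W) = Z q := fun A => Iff.rfl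
  have hcommQ : ∀ Z : Module.End ℂ W, Z * Θ = Θ * Z → ∀ q ∈ Q, Z q ∈ Q := fun Z hZ q hq =>
    (hQ _).2 (by rw [← Module.End.mul_apply, ← hZ, Module.End.mul_apply, (hQ q).1 hq, map_neg])
  have hcommP : ∀ Z : Module.End ℂ W, Z * Θ = Θ * Z → ∀ p ∈ P, Z p ∈ P := fun Z hZ p hp =>
    (hP _).2 (by rw [← Module.End.mul_apply, ← hZ, Module.End.mul_apply, (hP p).1 hp])
  have hres : ∀ Z ∈ 𝔊, Z * Θ = Θ * Z → ∃ A ∈ 𝔩, ∀ q : Q, ((A q : Q) : W) = Z q := fun Z hZ hZΘ =>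
    ⟨Z.restrict fun q hq => hcommQ Z hZΘ q hq, ⟨Z, hZ, hZΘ, fun q => rfl⟩, fun q => rfl⟩
  have hbr𝔩 : ∀ A ∈ 𝔩, ∀ A' ∈ 𝔩, A * A' - A' * A ∈ 𝔩 := by
    intro A hA A' hA'
    obtain ⟨Z, hZ, hZΘ, hAZ⟩ := (hmem𝔩 A).1 hA
    obtain ⟨Z', hZ', hZ'Θ, hAZ'⟩ := (hmem𝔩 A').1 hA'
    refine (hmem𝔩 _).2 ⟨Z * Z' - Z' * Z, hbr Z hZ Z' hZ', ?_, fun q => ?_⟩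
    · rw [sub_mul, mul_sub, mul_assoc, hZ'Θ, ← mul_assoc, hZΘ, mul_assoc, mul_assoc, hZΘ, ← mul_assoc Z', hZ'Θ,
        mul_assoc]
    · rw [LinearMap.sub_apply, Submodule.coe_sub, Module.End.mul_apply, Module.End.mul_apply, hAZ, hAZ', hAZ',
        hAZ, LinearMap.sub_apply, Module.End.mul_apply, Module.End.mul_apply]
  have hirr𝔩 := UnitaryTwoOdd.levi_irreducible hbr hirr hΘ hΘΘ hP hQ 𝔩 hres
  -- the idempotent `f = E|_Q` and the involution `T = 1 − 2f`
  set f : Module.End ℂ Q := E.restrict fun q (_ : q ∈ Q) => hEQ q with hfdef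
  have hfapply : ∀ q : Q, ((f q : Q) : W) = E q := fun q => rfl
  have hff : f * f = f := LinearMap.ext fun q => Subtype.ext (by
    rw [Module.End.mul_apply, hfapply, hfapply, hEE])
  set T : Module.End ℂ Q := 1 - (f + f) with hTdef
  have hTapply : ∀ q : Q, ((T q : Q) : W) = (q : W) - (E q + E q) := fun q => by
    rw [hTdef, LinearMap.sub_apply, Module.End.one_apply, LinearMap.add_apply, Submodule.coe_sub,
      Submodule.coe_add, hfapply]
  have hT𝔩 : T ∈ 𝔩 := by
    refine (hmem𝔩 T).2 ⟨-Θ - (E + E), Submodule.sub_mem _ (Submodule.neg_mem _ hΘ) (Submodule.add_mem _ hE hE),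
      ?_, fun q => ?_⟩
    · rw [sub_mul, mul_sub, add_mul, mul_add, hEΘ, neg_mul, mul_neg]
    · rw [hTapply, LinearMap.sub_apply, LinearMap.neg_apply, LinearMap.add_apply, (hQ _).1 q.2, neg_neg]
  have hTT : T * T = 1 := LinearMap.ext fun q => Subtype.ext (by
    rw [Module.End.mul_apply, Module.End.one_apply, hTapply, hTapply, map_sub, map_add, hEE]
    abel)
  -- its eigenspaces `P' = ker f` (`= C(P)`) and `Q' = range f` (`= K`)
  set P' : Submodule ℂ Q := LinearMap.ker f with hP'def
  set Q' : Submodule ℂ Q := LinearMap.range f with hQ'def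
  have hP' : ∀ x, x ∈ P' ↔ T x = x := fun x => by
    rw [hP'def, LinearMap.mem_ker]
    constructor
    · intro h
      apply Subtype.ext
      rw [hTapply, ← hfapply, h, Submodule.coe_zero, add_zero, sub_zero]
    · intro h
      have h' := congrArg Subtype.val h
      rw [hTapply, sub_eq_self, ← two_smul ℂ, smul_eq_zero] at h'
      exact Subtype.ext (by rw [hfapply]; exact h'.resolve_left two_ne_zero)
  have hQ'mem : ∀ x : Q, x ∈ Q' ↔ E x = x := fun x => by
    rw [hQ'def, LinearMap.mem_range]
    constructor
    · rintro ⟨y, rfl⟩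
      rw [hfapply, hEE]
    · intro h
      exact ⟨x, Subtype.ext (by rw [hfapply, h])⟩
  have hQ' : ∀ x, x ∈ Q' ↔ T x = -x := fun x => by
    rw [hQ'mem]
    constructor
    · intro h
      apply Subtype.ext
      rw [hTapply, h, Submodule.coe_neg]
      abel
    · intro h
      have h' := congrArg Subtype.val h
      rw [hTapply, Submodule.coe_neg] at h'
      have h3 := eq_neg_iff_add_eq_zero.1 h'
      have h2 : E x + E x = (x : W) + x := by
        rw [← sub_eq_zero, ← neg_eq_zero, ← h3]; abel
      rw [← two_smul ℂ (E (x : W)), ← two_smul ℂ (x : W)] at h2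
      exact smul_right_injective W (two_ne_zero' ℂ) h2
  have hP'eq : P' = Submodule.comap Q.subtype (P.map C) := by
    ext x
    rw [hP'def, LinearMap.mem_ker, Submodule.mem_comap, Submodule.subtype_apply]
    constructor
    · intro h
      exact hEker x x.2 (by rw [← hfapply, h, Submodule.coe_zero])
    · rintro ⟨p, hp, hpx⟩
      apply Subtype.ext
      rw [hfapply, Submodule.coe_zero, ← hpx, hECP p hp]
  have hQ'eq : Q' = Submodule.comap Q.subtype K := by
    ext x
    rw [hQ'mem, Submodule.mem_comap, Submodule.subtype_apply]
    constructor
    · intro h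
      rw [← h]; exact hEW x
    · intro h
      exact hEK x h
  have hfinP' : Module.finrank ℂ P' = a := by
    rw [hP'eq, (Submodule.comapSubtypeEquivOfLe hmapQ).finrank_eq, hfinmap, hPa]
  have hfinQ' : Module.finrank ℂ Q' = b - a := by
    rw [hQ'eq, (Submodule.comapSubtypeEquivOfLe hKQ).finrank_eq, hfinK]
  -- the Hermitian data on `Q`
  have hP'Q' : ∀ p' ∈ P', ∀ q' ∈ Q', s (p' : W) q' = 0 := by
    intro p' hp' q' hq'
    rw [hP'eq] at hp'
    obtain ⟨p, hp, hpp'⟩ := hp'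
    rw [hQ'eq] at hq'
    have hBq' : B q' = 0 := hBK _ hq'
    rw [Submodule.subtype_apply] at hpp'
    rw [← hpp', hsymm, ← hBC, hBq', h0l, map_zero]
  have hadj𝔩 : ∀ A ∈ 𝔩, ∃ A' ∈ 𝔩, ∀ x y : Q, s ((A x : Q) : W) y = s x ((A' y : Q) : W) := by
    intro A hA
    obtain ⟨Z, hZ, hZΘ, hAZ⟩ := (hmem𝔩 A).1 hA
    obtain ⟨Z', hZ', hZZ'⟩ := hadj Z hZ
    have hΘs := UnitaryTwoOdd.theta_selfAdjoint hadd hsymm hΘΘ hP hQ hPQ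
    have hZ'Θ : Z' * Θ = Θ * Z' := by
      refine LinearMap.ext fun y => ?_
      rw [← sub_eq_zero, ← LinearMap.sub_apply]
      refine UnitaryTwoOdd.eq_zero_of_forall_left hadd hsymm hΘΘ hP hQ hPQ hdefP hdefQ fun x => ?_
      rw [LinearMap.sub_apply, hsubr, Module.End.mul_apply, Module.End.mul_apply, ← hZZ', ← hΘs, ← hΘs, ← hZZ',
        ← Module.End.mul_apply, ← Module.End.mul_apply, hZΘ, sub_self]
    obtain ⟨A', hA', hA'Z'⟩ := hres Z' hZ' hZ'Θ
    exact ⟨A', hA', fun x y => by rw [hAZ, hA'Z', hZZ']⟩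
  -- the smaller core: `𝔩 = End(Q)`
  have h𝔩top : 𝔩 = ⊤ :=
    hIH 𝔩 T P' Q' hbr𝔩 hirr𝔩 hT𝔩 hTT hP' hQ' hfinP' hfinQ' hP'Q'
      (fun p _ h => Subtype.ext (hdefQ _ p.2 h)) (fun q _ h => Subtype.ext (hdefQ _ q.2 h)) hadj𝔩
  -- the `𝔑`-trick
  set 𝔑 : Submodule ℂ (Module.End ℂ Q) :=
    { carrier := {Y | ∃ N ∈ 𝔊, (∀ p ∈ P, N p = 0) ∧ ∀ q : Q, ((Y q : Q) : W) = N q}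
      zero_mem' := ⟨0, Submodule.zero_mem _, fun p _ => rfl, fun q => by simp⟩
      add_mem' := by
        rintro Y Y' ⟨N, hN, hNP, hYN⟩ ⟨N', hN', hN'P, hYN'⟩
        exact ⟨N + N', Submodule.add_mem _ hN hN', fun p hp => by
          rw [LinearMap.add_apply, hNP p hp, hN'P p hp, add_zero], fun q => by
          rw [LinearMap.add_apply, Submodule.coe_add, hYN, hYN', LinearMap.add_apply]⟩
      smul_mem' := by
        rintro c Y ⟨N, hN, hNP, hYN⟩
        exact ⟨c • N, Submodule.smul_mem _ c hN, fun p hp => by rw [LinearMap.smul_apply, hNP p hp, smul_zero],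
          fun q => by rw [LinearMap.smul_apply, Submodule.coe_smul, hYN, LinearMap.smul_apply]⟩ } with h𝔑def
  have hmem𝔑 : ∀ Y, Y ∈ 𝔑 ↔ ∃ N ∈ 𝔊, (∀ p ∈ P, N p = 0) ∧ ∀ q : Q, ((Y q : Q) : W) = N q := fun Y => Iff.rfl
  have hf𝔑 : f ∈ 𝔑 := (hmem𝔑 f).2 ⟨E, hE, hEP, hfapply⟩
  have had : ∀ A : Module.End ℂ Q, ∀ Y ∈ 𝔑, A * Y - Y * A ∈ 𝔑 := by
    intro A Y hY
    obtain ⟨Z, hZ, hZΘ, hAZ⟩ := (hmem𝔩 A).1 (h𝔩top ▸ Submodule.mem_top)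
    obtain ⟨N, hN, hNP, hYN⟩ := (hmem𝔑 Y).1 hY
    refine (hmem𝔑 _).2 ⟨Z * N - N * Z, hbr Z hZ N hN, fun p hp => ?_, fun q => ?_⟩
    · rw [LinearMap.sub_apply, Module.End.mul_apply, Module.End.mul_apply, hNP p hp, map_zero,
        hNP _ (hcommP Z hZΘ p hp), sub_zero]
    · rw [LinearMap.sub_apply, Submodule.coe_sub, Module.End.mul_apply, Module.End.mul_apply, hAZ, hYN, hYN, hAZ,
        LinearMap.sub_apply, Module.End.mul_apply, Module.End.mul_apply]
  have hf0 : f ≠ 0 := by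
    have hKpos : 0 < Module.finrank ℂ K := by rw [hfinK]; omega
    obtain ⟨⟨k, hk⟩, hk0⟩ := Module.finrank_pos_iff_exists_ne_zero.1 hKpos
    intro hf
    apply hk0
    apply Subtype.ext
    have h := hfapply ⟨k, hKQ hk⟩
    rw [hf, LinearMap.zero_apply, Submodule.coe_zero, hEK k hk] at h
    exact h.symm
  have hf1 : f ≠ 1 := by
    obtain ⟨p₀, hp₀0, hp₀⟩ := hP0
    have hp₀P : p₀ ∈ P := (hP p₀).2 hp₀
    intro hf
    have h := hfapply ⟨C p₀, hCmem p₀⟩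
    rw [hf, Module.End.one_apply, hECP p₀ hp₀P] at h
    exact hp₀0 (hCinj p₀ hp₀P h)
  obtain ⟨u, φ, hφu, hφ𝔑⟩ := UnitaryTwoOdd.exists_rankOne_of_adStable 𝔑 had hf𝔑 hff hf0 hf1
  obtain ⟨N, hN, hNP, hNq⟩ := (hmem𝔑 _).1 hφ𝔑
  -- `N = (φ ∘ π_Q) ⊗ u` is a rank-one idempotent of `W` in `𝔊`
  set πQ : W →ₗ[ℂ] Q := LinearMap.codRestrict Q ((2 : ℂ)⁻¹ • ((1 : Module.End ℂ W) - Θ)) fun w => by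
    rw [LinearMap.smul_apply, LinearMap.sub_apply, Module.End.one_apply]; exact hQhat w with hπQdef
  have hπapply : ∀ w, (πQ w : W) = (2 : ℂ)⁻¹ • (w - Θ w) := fun w => rfl
  have hπq : ∀ q : Q, πQ q = q := fun q => Subtype.ext (by
    rw [hπapply, (hQ _).1 q.2, sub_neg_eq_add, ← two_smul ℂ (q : W), smul_smul, inv_mul_cancel₀ two_ne_zero,
      one_smul])
  refine ⟨u, φ ∘ₗ πQ, by rw [LinearMap.comp_apply, hπq, hφu], ?_⟩
  have hNeq : (φ ∘ₗ πQ).smulRight (u : W) = N := by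
    refine LinearMap.ext fun w => ?_
    rw [LinearMap.smulRight_apply, LinearMap.comp_apply]
    conv_rhs => rw [← hsplit w, map_add, hNP _ (hPhat w), zero_add]
    have h := hNq (πQ w)
    rw [LinearMap.smulRight_apply, Submodule.coe_smul] at h
    rw [h, hπapply]
  rw [hNeq]
  exact hN

/-! ### §3 The cores `(4,5)`, `(5,7)`, `(6,7)` and their mirrors -/

/-- **THE `(4, 5)` CORE** (Ribet's Thm. 3 at `(4,5)`, classification-free): rank raised by the cores `(2|3)`, `(3|2)`;
Levi step by the `(4|1)` core. [cite: Ribet1983, Thm. 3] [cite: Gordon1997, Thm. 6.3 (3)] -/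
theorem UnitaryCoprimeStep.eq_top_four_five [FiniteDimensional ℂ W] {𝔊 : Submodule ℂ (Module.End ℂ W)}
    (hbr : ∀ Y ∈ 𝔊, ∀ Z ∈ 𝔊, Y * Z - Z * Y ∈ 𝔊)
    (hirr : ∀ U : Submodule ℂ W, (∀ A ∈ 𝔊, ∀ u ∈ U, A u ∈ U) → U = ⊥ ∨ U = ⊤)
    {Θ : Module.End ℂ W} (hΘ : Θ ∈ 𝔊) (hΘΘ : Θ * Θ = 1)
    {P Q : Submodule ℂ W} (hP : ∀ x, x ∈ P ↔ Θ x = x) (hQ : ∀ x, x ∈ Q ↔ Θ x = -x)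
    (hP4 : Module.finrank ℂ P = 4) (hQ5 : Module.finrank ℂ Q = 5)
    {s : W → W → ℂ} (hadd : ∀ x y z, s (x + y) z = s x z + s y z) (hsymm : ∀ x y, s y x = starRingEnd ℂ (s x y))
    (hPQ : ∀ p ∈ P, ∀ q ∈ Q, s p q = 0) (hdefP : ∀ p ∈ P, s p p = 0 → p = 0) (hdefQ : ∀ q ∈ Q, s q q = 0 → q = 0)
    (hadj : ∀ X ∈ 𝔊, ∃ Y ∈ 𝔊, ∀ x y, s (X x) y = s x (Y y)) : 𝔊 = ⊤ := by
  refine UnitaryCoprimeStep.eq_top_of_onto_of_core hbr hirr hΘ hΘΘ hP hQ hP4 hQ5 (by norm_num) (by norm_num) hadd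
    hsymm hPQ hdefP hdefQ hadj ?_ ?_
  · refine UnitaryCoprimeStep.exists_raise_onto_of_cores hbr hirr hΘ hΘΘ hP hQ hP4 (by norm_num) (by omega) hadd
      hsymm hPQ hdefP hdefQ hadj fun r h2r hra U 𝔩 ι P' Q' hbr𝔩 hirr𝔩 hι hιι hP' hQ' hfinP' hfinQ' hP'Q' hdefP' hdefQ'
        hadj𝔩 => ?_
    interval_cases r
    · exact UnitaryTwoOdd.eq_top hbr𝔩 hirr𝔩 hι hιι hP' hQ' hfinP' ⟨1, by omega⟩
        (s := fun x y : U => s (x : W) y) (fun x y z => by simp only [Submodule.coe_add, hadd])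
          (fun x y => hsymm x y) hP'Q' hdefP' hdefQ' hadj𝔩
    · exact UnitaryThreeCoprime.eq_top hbr𝔩 hirr𝔩 hι hιι hP' hQ' hfinP' (by omega)
        (s := fun x y : U => s (x : W) y) (fun x y z => by simp only [Submodule.coe_add, hadd])
          (fun x y => hsymm x y) hP'Q' hdefP' hdefQ' hadj𝔩
  · intro 𝔩 ι P' Q' hbr𝔩 hirr𝔩 hι hιι hP' hQ' hfinP' hfinQ' hP'Q' hdefP' hdefQ' hadj𝔩
    exact UnitaryThreeCoprime.eq_top_of_finrank_eq_one hbr𝔩 hirr𝔩 hι hιι hP' hQ' (by omega) (by omega)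

/-- The mirror core `(5, 4)` (apply `eq_top_four_five` to `−Θ`). [cite: Ribet1983, Thm. 3] [cite: Gordon1997, Thm. 6.3 (3)] -/
theorem UnitaryCoprimeStep.eq_top_five_four [FiniteDimensional ℂ W] {𝔊 : Submodule ℂ (Module.End ℂ W)}
    (hbr : ∀ Y ∈ 𝔊, ∀ Z ∈ 𝔊, Y * Z - Z * Y ∈ 𝔊)
    (hirr : ∀ U : Submodule ℂ W, (∀ A ∈ 𝔊, ∀ u ∈ U, A u ∈ U) → U = ⊥ ∨ U = ⊤)
    {Θ : Module.End ℂ W} (hΘ : Θ ∈ 𝔊) (hΘΘ : Θ * Θ = 1)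
    {P Q : Submodule ℂ W} (hP : ∀ x, x ∈ P ↔ Θ x = x) (hQ : ∀ x, x ∈ Q ↔ Θ x = -x)
    (hP5 : Module.finrank ℂ P = 5) (hQ4 : Module.finrank ℂ Q = 4)
    {s : W → W → ℂ} (hadd : ∀ x y z, s (x + y) z = s x z + s y z) (hsymm : ∀ x y, s y x = starRingEnd ℂ (s x y))
    (hPQ : ∀ p ∈ P, ∀ q ∈ Q, s p q = 0) (hdefP : ∀ p ∈ P, s p p = 0 → p = 0) (hdefQ : ∀ q ∈ Q, s q q = 0 → q = 0)
    (hadj : ∀ X ∈ 𝔊, ∃ Y ∈ 𝔊, ∀ x y, s (X x) y = s x (Y y)) : 𝔊 = ⊤ := by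
  have hnΘ : -Θ ∈ 𝔊 := Submodule.neg_mem _ hΘ
  have hnΘΘ : (-Θ) * (-Θ) = 1 := by rw [neg_mul_neg, hΘΘ]
  exact UnitaryCoprimeStep.eq_top_four_five hbr hirr hnΘ hnΘΘ (P := Q) (Q := P)
    (fun x => by rw [hQ, LinearMap.neg_apply, neg_eq_iff_eq_neg]) (fun x => by rw [hP, LinearMap.neg_apply, neg_inj])
    hQ4 hP5 hadd hsymm (fun q hq p hp => by rw [hsymm, hPQ p hp q hq, map_zero]) hdefQ hdefP hadj

/-- **THE `(5, 7)` CORE** (Ribet's Thm. 3 at `(5,7)`): rank raised by `(2|5)`, `(3|4)`, `(4|3)`; Levi step by `(5|2)`.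
[cite: Ribet1983, Thm. 3] [cite: Gordon1997, Thm. 6.3 (3)] -/
theorem UnitaryCoprimeStep.eq_top_five_seven [FiniteDimensional ℂ W] {𝔊 : Submodule ℂ (Module.End ℂ W)}
    (hbr : ∀ Y ∈ 𝔊, ∀ Z ∈ 𝔊, Y * Z - Z * Y ∈ 𝔊)
    (hirr : ∀ U : Submodule ℂ W, (∀ A ∈ 𝔊, ∀ u ∈ U, A u ∈ U) → U = ⊥ ∨ U = ⊤)
    {Θ : Module.End ℂ W} (hΘ : Θ ∈ 𝔊) (hΘΘ : Θ * Θ = 1)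
    {P Q : Submodule ℂ W} (hP : ∀ x, x ∈ P ↔ Θ x = x) (hQ : ∀ x, x ∈ Q ↔ Θ x = -x)
    (hP5 : Module.finrank ℂ P = 5) (hQ7 : Module.finrank ℂ Q = 7)
    {s : W → W → ℂ} (hadd : ∀ x y z, s (x + y) z = s x z + s y z) (hsymm : ∀ x y, s y x = starRingEnd ℂ (s x y))
    (hPQ : ∀ p ∈ P, ∀ q ∈ Q, s p q = 0) (hdefP : ∀ p ∈ P, s p p = 0 → p = 0) (hdefQ : ∀ q ∈ Q, s q q = 0 → q = 0)
    (hadj : ∀ X ∈ 𝔊, ∃ Y ∈ 𝔊, ∀ x y, s (X x) y = s x (Y y)) : 𝔊 = ⊤ := by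
  refine UnitaryCoprimeStep.eq_top_of_onto_of_core hbr hirr hΘ hΘΘ hP hQ hP5 hQ7 (by norm_num) (by norm_num) hadd
    hsymm hPQ hdefP hdefQ hadj ?_ ?_
  · refine UnitaryCoprimeStep.exists_raise_onto_of_cores hbr hirr hΘ hΘΘ hP hQ hP5 (by norm_num) (by omega) hadd
      hsymm hPQ hdefP hdefQ hadj fun r h2r hra U 𝔩 ι P' Q' hbr𝔩 hirr𝔩 hι hιι hP' hQ' hfinP' hfinQ' hP'Q' hdefP' hdefQ'
        hadj𝔩 => ?_
    interval_cases r
    · exact UnitaryTwoOdd.eq_top hbr𝔩 hirr𝔩 hι hιι hP' hQ' hfinP' ⟨2, by omega⟩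
        (s := fun x y : U => s (x : W) y) (fun x y z => by simp only [Submodule.coe_add, hadd])
          (fun x y => hsymm x y) hP'Q' hdefP' hdefQ' hadj𝔩
    · exact UnitaryThreeCoprime.eq_top hbr𝔩 hirr𝔩 hι hιι hP' hQ' hfinP' (by omega)
        (s := fun x y : U => s (x : W) y) (fun x y z => by simp only [Submodule.coe_add, hadd])
          (fun x y => hsymm x y) hP'Q' hdefP' hdefQ' hadj𝔩
    · exact UnitaryThreeCoprime.eq_top' hbr𝔩 hirr𝔩 hι hιι hP' hQ' (by omega) (by omega)
        (s := fun x y : U => s (x : W) y) (fun x y z => by simp only [Submodule.coe_add, hadd])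
          (fun x y => hsymm x y) hP'Q' hdefP' hdefQ' hadj𝔩
  · intro 𝔩 ι P' Q' hbr𝔩 hirr𝔩 hι hιι hP' hQ' hfinP' hfinQ' hP'Q' hdefP' hdefQ' hadj𝔩
    exact UnitaryTwoOdd.eq_top' hbr𝔩 hirr𝔩 hι hιι hP' hQ' (by rw [hfinP']; exact ⟨2, rfl⟩) (by omega)
      (s := fun x y : Q => s (x : W) y) (fun x y z => by simp only [Submodule.coe_add, hadd])
        (fun x y => hsymm x y) hP'Q' hdefP' hdefQ' hadj𝔩

/-- The mirror core `(7, 5)` (apply `eq_top_five_seven` to `−Θ`). [cite: Ribet1983, Thm. 3] [cite: Gordon1997, Thm. 6.3 (3)] -/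
theorem UnitaryCoprimeStep.eq_top_seven_five [FiniteDimensional ℂ W] {𝔊 : Submodule ℂ (Module.End ℂ W)}
    (hbr : ∀ Y ∈ 𝔊, ∀ Z ∈ 𝔊, Y * Z - Z * Y ∈ 𝔊)
    (hirr : ∀ U : Submodule ℂ W, (∀ A ∈ 𝔊, ∀ u ∈ U, A u ∈ U) → U = ⊥ ∨ U = ⊤)
    {Θ : Module.End ℂ W} (hΘ : Θ ∈ 𝔊) (hΘΘ : Θ * Θ = 1)
    {P Q : Submodule ℂ W} (hP : ∀ x, x ∈ P ↔ Θ x = x) (hQ : ∀ x, x ∈ Q ↔ Θ x = -x)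
    (hP7 : Module.finrank ℂ P = 7) (hQ5 : Module.finrank ℂ Q = 5)
    {s : W → W → ℂ} (hadd : ∀ x y z, s (x + y) z = s x z + s y z) (hsymm : ∀ x y, s y x = starRingEnd ℂ (s x y))
    (hPQ : ∀ p ∈ P, ∀ q ∈ Q, s p q = 0) (hdefP : ∀ p ∈ P, s p p = 0 → p = 0) (hdefQ : ∀ q ∈ Q, s q q = 0 → q = 0)
    (hadj : ∀ X ∈ 𝔊, ∃ Y ∈ 𝔊, ∀ x y, s (X x) y = s x (Y y)) : 𝔊 = ⊤ := by
  have hnΘ : -Θ ∈ 𝔊 := Submodule.neg_mem _ hΘ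
  have hnΘΘ : (-Θ) * (-Θ) = 1 := by rw [neg_mul_neg, hΘΘ]
  exact UnitaryCoprimeStep.eq_top_five_seven hbr hirr hnΘ hnΘΘ (P := Q) (Q := P)
    (fun x => by rw [hQ, LinearMap.neg_apply, neg_eq_iff_eq_neg]) (fun x => by rw [hP, LinearMap.neg_apply, neg_inj])
    hQ5 hP7 hadd hsymm (fun q hq p hp => by rw [hsymm, hPQ p hp q hq, map_zero]) hdefQ hdefP hadj

/-- **THE `(6, 7)` CORE** (Ribet's Thm. 3 at `(6,7)` — the prime dimension `13`): rank raised by `(2|5)`, `(3|4)`,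
`(4|3)`, `(5|2)`; Levi step by `(6|1)`. [cite: Ribet1983, Thm. 3] [cite: Gordon1997, Thm. 6.3 (3)]
[cite: MoonenZarhin1999LowDim, Thm. (2.7)] -/
theorem UnitaryCoprimeStep.eq_top_six_seven [FiniteDimensional ℂ W] {𝔊 : Submodule ℂ (Module.End ℂ W)}
    (hbr : ∀ Y ∈ 𝔊, ∀ Z ∈ 𝔊, Y * Z - Z * Y ∈ 𝔊)
    (hirr : ∀ U : Submodule ℂ W, (∀ A ∈ 𝔊, ∀ u ∈ U, A u ∈ U) → U = ⊥ ∨ U = ⊤)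
    {Θ : Module.End ℂ W} (hΘ : Θ ∈ 𝔊) (hΘΘ : Θ * Θ = 1)
    {P Q : Submodule ℂ W} (hP : ∀ x, x ∈ P ↔ Θ x = x) (hQ : ∀ x, x ∈ Q ↔ Θ x = -x)
    (hP6 : Module.finrank ℂ P = 6) (hQ7 : Module.finrank ℂ Q = 7)
    {s : W → W → ℂ} (hadd : ∀ x y z, s (x + y) z = s x z + s y z) (hsymm : ∀ x y, s y x = starRingEnd ℂ (s x y))
    (hPQ : ∀ p ∈ P, ∀ q ∈ Q, s p q = 0) (hdefP : ∀ p ∈ P, s p p = 0 → p = 0) (hdefQ : ∀ q ∈ Q, s q q = 0 → q = 0)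
    (hadj : ∀ X ∈ 𝔊, ∃ Y ∈ 𝔊, ∀ x y, s (X x) y = s x (Y y)) : 𝔊 = ⊤ := by
  refine UnitaryCoprimeStep.eq_top_of_onto_of_core hbr hirr hΘ hΘΘ hP hQ hP6 hQ7 (by norm_num) (by norm_num) hadd
    hsymm hPQ hdefP hdefQ hadj ?_ ?_
  · refine UnitaryCoprimeStep.exists_raise_onto_of_cores hbr hirr hΘ hΘΘ hP hQ hP6 (by norm_num) (by omega) hadd
      hsymm hPQ hdefP hdefQ hadj fun r h2r hra U 𝔩 ι P' Q' hbr𝔩 hirr𝔩 hι hιι hP' hQ' hfinP' hfinQ' hP'Q' hdefP' hdefQ'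
        hadj𝔩 => ?_
    interval_cases r
    · exact UnitaryTwoOdd.eq_top hbr𝔩 hirr𝔩 hι hιι hP' hQ' hfinP' ⟨2, by omega⟩
        (s := fun x y : U => s (x : W) y) (fun x y z => by simp only [Submodule.coe_add, hadd])
          (fun x y => hsymm x y) hP'Q' hdefP' hdefQ' hadj𝔩
    · exact UnitaryThreeCoprime.eq_top hbr𝔩 hirr𝔩 hι hιι hP' hQ' hfinP' (by omega)
        (s := fun x y : U => s (x : W) y) (fun x y z => by simp only [Submodule.coe_add, hadd])
          (fun x y => hsymm x y) hP'Q' hdefP' hdefQ' hadj𝔩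
    · exact UnitaryThreeCoprime.eq_top' hbr𝔩 hirr𝔩 hι hιι hP' hQ' (by omega) (by omega)
        (s := fun x y : U => s (x : W) y) (fun x y z => by simp only [Submodule.coe_add, hadd])
          (fun x y => hsymm x y) hP'Q' hdefP' hdefQ' hadj𝔩
    · exact UnitaryTwoOdd.eq_top' hbr𝔩 hirr𝔩 hι hιι hP' hQ' (by rw [hfinP']; exact ⟨2, rfl⟩) (by omega)
        (s := fun x y : U => s (x : W) y) (fun x y z => by simp only [Submodule.coe_add, hadd])
          (fun x y => hsymm x y) hP'Q' hdefP' hdefQ' hadj𝔩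
  · intro 𝔩 ι P' Q' hbr𝔩 hirr𝔩 hι hιι hP' hQ' hfinP' hfinQ' hP'Q' hdefP' hdefQ' hadj𝔩
    exact UnitaryThreeCoprime.eq_top_of_finrank_eq_one hbr𝔩 hirr𝔩 hι hιι hP' hQ' (by omega) (by omega)

/-- The mirror core `(7, 6)` (apply `eq_top_six_seven` to `−Θ`). [cite: Ribet1983, Thm. 3] [cite: Gordon1997, Thm. 6.3 (3)] -/
theorem UnitaryCoprimeStep.eq_top_seven_six [FiniteDimensional ℂ W] {𝔊 : Submodule ℂ (Module.End ℂ W)}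
    (hbr : ∀ Y ∈ 𝔊, ∀ Z ∈ 𝔊, Y * Z - Z * Y ∈ 𝔊)
    (hirr : ∀ U : Submodule ℂ W, (∀ A ∈ 𝔊, ∀ u ∈ U, A u ∈ U) → U = ⊥ ∨ U = ⊤)
    {Θ : Module.End ℂ W} (hΘ : Θ ∈ 𝔊) (hΘΘ : Θ * Θ = 1)
    {P Q : Submodule ℂ W} (hP : ∀ x, x ∈ P ↔ Θ x = x) (hQ : ∀ x, x ∈ Q ↔ Θ x = -x)
    (hP7 : Module.finrank ℂ P = 7) (hQ6 : Module.finrank ℂ Q = 6)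
    {s : W → W → ℂ} (hadd : ∀ x y z, s (x + y) z = s x z + s y z) (hsymm : ∀ x y, s y x = starRingEnd ℂ (s x y))
    (hPQ : ∀ p ∈ P, ∀ q ∈ Q, s p q = 0) (hdefP : ∀ p ∈ P, s p p = 0 → p = 0) (hdefQ : ∀ q ∈ Q, s q q = 0 → q = 0)
    (hadj : ∀ X ∈ 𝔊, ∃ Y ∈ 𝔊, ∀ x y, s (X x) y = s x (Y y)) : 𝔊 = ⊤ := by
  have hnΘ : -Θ ∈ 𝔊 := Submodule.neg_mem _ hΘ
  have hnΘΘ : (-Θ) * (-Θ) = 1 := by rw [neg_mul_neg, hΘΘ]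
  exact UnitaryCoprimeStep.eq_top_six_seven hbr hirr hnΘ hnΘΘ (P := Q) (Q := P)
    (fun x => by rw [hQ, LinearMap.neg_apply, neg_eq_iff_eq_neg]) (fun x => by rw [hP, LinearMap.neg_apply, neg_inj])
    hQ6 hP7 hadd hsymm (fun q hq p hp => by rw [hsymm, hPQ p hp q hq, map_zero]) hdefQ hdefP hadj

end Main

end HodgeStructure

end Literature.AlgebraicGeometry.Motives

end
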